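import Summits.ResolutionOfSingularities.ResolutionOfSingularities.Theorems.DeltaCutStellar

/-!
# DeltaCutStellarCells — tree file 2/2 of the decomp-res lens-6 g32 node «StellarCut»: §NCCells — the cells `WORNC`, `WORNCHyp`,
# `WORTopSHeavyNC`, `WORTopSHeavyOffNC`, `WORTopSFrozenOffNC`, `WORTopSPerpetualOffNC`, `NCEntryPerpetual`, the exact iffs, the
# carve `worTopSHeavy_of_nc : WORNC n → WORNCHyp n → NCEntryPerpetual n → WORTopSFrozenOffNC n → WORTopSHeavy n`, the family
# versions and the column edges `e1TopGHeavy_of_nc` (aside 27045), `e1TopNoAbs_of_nc` (item 26971), `e_one_of_nc` (see file 1/2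
# `DeltaCutStellar` for the thesis, the letters `IsNCStage` / `IsNCHypStage` / `IsNCRegime` / `EverNC`, the transport theorems, the
# kangaroo desk negative, the honesty paragraph and the sources).  All cells HYPOTHESIS-FREE; 0 sorry. [new] [folklore]
-/

noncomputable section

open CategoryTheory CategoryTheory.Limits AlgebraicGeometry TopologicalSpace IsLocalRing
open Literature.AlgebraicGeometry.Resolution

namespace Summit.ResolutionOfSingularities.ResolutionOfSingularities.Theorems.DeltaCutClasses

open Summit.ResolutionOfSingularities.ResolutionOfSingularities.Theorems.TwistCutClasses
open Summit.ResolutionOfSingularities.ResolutionOfSingularities.Theorems.LightCutClasses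

section NCCells

open Summit.ResolutionOfSingularities.ResolutionOfSingularities.Theorems
open WeakOrderReduction ForcedTowerClasses SubfieldContactClasses AbsoluteContactClasses PurityValveClasses

/-! ### §NCCells — THE CELLS AND THE CARVE (hypothesis-free): the barrier's complement `WORNC`, the hypersurface-shape law
`WORNCHyp`, the residual's n.c. part, the off-n.c. remainders by kind, the entry conjecture for P‴, the exact iffs, the family
versions and the column edges -/

/-- **THE COMPLEMENT OF THE SING-FIRST BARRIER · `WORNC n`** — every base `n`-datum whose stage IS an ideal-shape labelled
n.c.-monomial square-contact stage has a weak resolution.  UNDECIDED · ATTACKABLE: the centres of the attacking law are WHOLE FACES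
`H ∩ ⋂_{i∈F} Dᵢ` of the labelled complex chosen minimal among the permissible ones — by construction outside the hypothesis of g31
Theorem B / `StratumFirstInvIncrease` (never the singular locus of the configuration unless it is a minimal face), outside
Narasimhan's no-maximal-contact barrier and the residual-order barriers (`hⁿ ∈ 𝓘`: `H` is a PERMANENT contact hypersurface; no
maximal contact, directrix or residual order is used; the invariant is the label list, which the blow-up updates affinely), and
its termination on EVERY labelled complex is g31 Theorem A `Nerve.no_infinite_minPlay` (kernel, list level); what is missing is the
scheme ↔ nerve transfer (g33).  Contains TAME members (decided mod `E 5`) and the P‴ inhabitants D₀, D₁. -/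
def WORNC (n : ℕ) : Prop :=
  ∀ p : ℕ, p.Prime → ∀ (k : Type) [Field k] [CharP k p] (Y : Scheme.{0}) (g : Y ⟶ Spec (.of k)),
    IsBase Y g → ∀ M : MarkedIdeal Y, IsDatum n M → IsNCStage n ⟨Y, M.ideal⟩ → ∃ t : CentreSeq Y, WeakResolution t M

/-- **THE HYPERSURFACE-SHAPE N.C. LAW · `WORNCHyp n`** — every base `n`-datum whose stage is a hypersurface-shape labelled n.c.
stage has a weak resolution.  UNDECIDED · IDEA-NEEDED: the face law meets KANGAROO births (the desk negative `x² + (1 + xz)·z²w²`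
of the module docstring: at a label-`0` birth the top locus leaves `H′` along a new contact hypersurface) — a frame-change theory
is needed; this cell is NOT claimed to lie outside Narasimhan's barrier.  Contains the F-ss² inhabitant T₃ and the hypersurface
companions `x² + t·z⁶w⁶` of D₀. -/
def WORNCHyp (n : ℕ) : Prop :=
  ∀ p : ℕ, p.Prime → ∀ (k : Type) [Field k] [CharP k p] (Y : Scheme.{0}) (g : Y ⟶ Spec (.of k)),
    IsBase Y g → ∀ M : MarkedIdeal Y, IsDatum n M → IsNCHypStage n ⟨Y, M.ideal⟩ → ∃ t : CentreSeq Y, WeakResolution t M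

/-- **THE N.C. PART OF THE RESIDUAL · `WORTopSHeavyNC n`** — weak resolution for the residual's base data (binders of
`WORTopSHeavy n` VERBATIM) SOME level of whose singular run is in the n.c. regime.  UNDECIDED (⟸ `WORNC n ∧ WORNCHyp n`,
`worTopSHeavyNC_of_laws`; contains T₃, D₀, D₁). -/
def WORTopSHeavyNC (n : ℕ) : Prop :=
  ∀ p : ℕ, p.Prime → ∀ (k : Type) [Field k] [CharP k p] (Y : Scheme.{0}) (g : Y ⟶ Spec (.of k)),
    IsBase Y g → ∀ M : MarkedIdeal Y, IsDatum n M → TopHeavy Y M.ideal n → TopDeltaHeavy Y M.ideal n →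
      TopChainHeavy Y M.ideal n → ¬ RunTerminates n ⟨Y, M.ideal⟩ → ¬ SepTerminates n ⟨Y, M.ideal⟩ →
        ¬ RefTerminates n ⟨⟨Y, M.ideal⟩, none⟩ → ¬ GTerminates n ⟨⟨Y, M.ideal⟩, none⟩ →
          ¬ STerminates n ⟨⟨Y, M.ideal⟩, none⟩ → EverNC n ⟨⟨Y, M.ideal⟩, none⟩ → ∃ t : CentreSeq Y, WeakResolution t M

/-- **THE OFF-N.C. REMAINDER OF THE RESIDUAL · `WORTopSHeavyOffNC n`** — the residual's base data NO level of whose singular run is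
in the n.c. regime.  RESIDUAL (= `WORTopSFrozenOffNC n ∧ WORTopSPerpetualOffNC n` exactly, `worTopSHeavyOffNC_iff`). -/
def WORTopSHeavyOffNC (n : ℕ) : Prop :=
  ∀ p : ℕ, p.Prime → ∀ (k : Type) [Field k] [CharP k p] (Y : Scheme.{0}) (g : Y ⟶ Spec (.of k)),
    IsBase Y g → ∀ M : MarkedIdeal Y, IsDatum n M → TopHeavy Y M.ideal n → TopDeltaHeavy Y M.ideal n →
      TopChainHeavy Y M.ideal n → ¬ RunTerminates n ⟨Y, M.ideal⟩ → ¬ SepTerminates n ⟨Y, M.ideal⟩ →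
        ¬ RefTerminates n ⟨⟨Y, M.ideal⟩, none⟩ → ¬ GTerminates n ⟨⟨Y, M.ideal⟩, none⟩ →
          ¬ STerminates n ⟨⟨Y, M.ideal⟩, none⟩ → ¬ EverNC n ⟨⟨Y, M.ideal⟩, none⟩ → ∃ t : CentreSeq Y, WeakResolution t M

/-- **OFF-N.C. REMAINDER of KIND F-ss² · `WORTopSFrozenOffNC n`** — F-ss² data (binders of `WORTopSFrozen n` VERBATIM) no level of
whose singular run is in the n.c. regime.  RESIDUAL: MISSES T₃ (hypersurface-n.c. at its frozen level `0`); PAPER candidate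
inhabitant `(x², (z²w² − y⁵)²)`, char 2 (bad closure the irreducible non-normal-crossings surface `V(x, z²w² − y⁵)`, singular
along two crossing lines — frozen at level `0`; not principal, not of ideal shape) — NOT claimed.  Leaf: IDEA-NEEDED (embedded
resolution of the surface part WITH boundary, `CossartJannsenSaito2020EmbeddedSequenceBoundary`, as the entry phase). -/
def WORTopSFrozenOffNC (n : ℕ) : Prop :=
  ∀ p : ℕ, p.Prime → ∀ (k : Type) [Field k] [CharP k p] (Y : Scheme.{0}) (g : Y ⟶ Spec (.of k)),
    IsBase Y g → ∀ M : MarkedIdeal Y, IsDatum n M → TopHeavy Y M.ideal n → TopDeltaHeavy Y M.ideal n →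
      TopChainHeavy Y M.ideal n → ¬ RunTerminates n ⟨Y, M.ideal⟩ → ¬ SepTerminates n ⟨Y, M.ideal⟩ →
        ¬ RefTerminates n ⟨⟨Y, M.ideal⟩, none⟩ → ¬ GTerminates n ⟨⟨Y, M.ideal⟩, none⟩ →
          SFrozen n ⟨⟨Y, M.ideal⟩, none⟩ → ¬ EverNC n ⟨⟨Y, M.ideal⟩, none⟩ → ∃ t : CentreSeq Y, WeakResolution t M

/-- **OFF-N.C. REMAINDER of KIND P‴ · `WORTopSPerpetualOffNC n`** — P‴ data (binders of `WORTopSPerpetual n` VERBATIM) no level of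
whose singular run is in the n.c. regime.  RESIDUAL · conjecturally VACUOUS (`worTopSPerpetualOffNC_of_entry`): NO inhabitant
known — D₀, D₁, `x² + t·z⁶w⁶` are in the regime at level `0`, `(x², (z² − w³)⁴)` at level `3` (paper, g31). -/
def WORTopSPerpetualOffNC (n : ℕ) : Prop :=
  ∀ p : ℕ, p.Prime → ∀ (k : Type) [Field k] [CharP k p] (Y : Scheme.{0}) (g : Y ⟶ Spec (.of k)),
    IsBase Y g → ∀ M : MarkedIdeal Y, IsDatum n M → TopHeavy Y M.ideal n → TopDeltaHeavy Y M.ideal n →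
      TopChainHeavy Y M.ideal n → ¬ RunTerminates n ⟨Y, M.ideal⟩ → ¬ SepTerminates n ⟨Y, M.ideal⟩ →
        ¬ RefTerminates n ⟨⟨Y, M.ideal⟩, none⟩ → ¬ GTerminates n ⟨⟨Y, M.ideal⟩, none⟩ →
          SPerpetual n ⟨⟨Y, M.ideal⟩, none⟩ → ¬ EverNC n ⟨⟨Y, M.ideal⟩, none⟩ → ∃ t : CentreSeq Y, WeakResolution t M

/-- **THE ENTRY CONJECTURE for kind P‴ · `NCEntryPerpetual n`** — every P‴ base datum (binders of `WORTopSPerpetual n` VERBATIM)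
has SOME level of its singular run in the n.c. regime.  UNDECIDED · structural (no resolution content) · TEST: the entry level
on the four test families — `(x², (zw)^c)`, `(x², zᵃwᵇ)`, `(x², (yzw)^c)` are in the regime at level `0`; `(x², (z² − w³)^c)`:
`c = 4` enters at level `3` (paper); general `c` = the instrument run.  A REFUTATION (a perpetual singular run that never enters
the regime) is a NEW KIND «off-n.c. perpetual» and re-locates the residual to `WORTopSPerpetualOffNC`. -/
def NCEntryPerpetual (n : ℕ) : Prop :=
  ∀ p : ℕ, p.Prime → ∀ (k : Type) [Field k] [CharP k p] (Y : Scheme.{0}) (g : Y ⟶ Spec (.of k)),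
    IsBase Y g → ∀ M : MarkedIdeal Y, IsDatum n M → TopHeavy Y M.ideal n → TopDeltaHeavy Y M.ideal n →
      TopChainHeavy Y M.ideal n → ¬ RunTerminates n ⟨Y, M.ideal⟩ → ¬ SepTerminates n ⟨Y, M.ideal⟩ →
        ¬ RefTerminates n ⟨⟨Y, M.ideal⟩, none⟩ → ¬ GTerminates n ⟨⟨Y, M.ideal⟩, none⟩ →
          SPerpetual n ⟨⟨Y, M.ideal⟩, none⟩ → EverNC n ⟨⟨Y, M.ideal⟩, none⟩

/-- the two n.c. laws resolve the residual's n.c. part (transport `wor_of_ever` with `Q = IsNCRegime n`). [new] [folklore] -/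
theorem worTopSHeavyNC_of_laws {n : ℕ} (hW : WORNC n) (hH : WORNCHyp n) : WORTopSHeavyNC n :=
  fun p hp k _ _ _ _ hB _ hM _ _ _ _ _ _ _ _ hE =>
    wor_of_ever (Q := IsNCRegime n)
      (fun Y' g' hB' M' hM' hR => hR.elim (hW p hp k Y' g' hB' M' hM') (hH p hp k Y' g' hB' M' hM')) hB hM hE

/-- **EXACT CARVE of the residual by the regime letter** (hypothesis-free, excluded middle on `EverNC`):
`WORTopSHeavy n ⟺ WORTopSHeavyNC n ∧ WORTopSHeavyOffNC n`. [new] [folklore] -/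
theorem worTopSHeavy_iff_nc_offNC (n : ℕ) : WORTopSHeavy n ↔ WORTopSHeavyNC n ∧ WORTopSHeavyOffNC n := by
  constructor
  · intro h
    exact ⟨fun p hp k _ _ Y g hB M hM hT hD hC hr hs hf hg hS _ => h p hp k Y g hB M hM hT hD hC hr hs hf hg hS,
      fun p hp k _ _ Y g hB M hM hT hD hC hr hs hf hg hS _ => h p hp k Y g hB M hM hT hD hC hr hs hf hg hS⟩
  · rintro ⟨hN, hO⟩ p hp k _ _ Y g hB M hM hT hD hC hr hs hf hg hS
    by_cases hE : EverNC n ⟨⟨Y, M.ideal⟩, none⟩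
    · exact hN p hp k Y g hB M hM hT hD hC hr hs hf hg hS hE
    · exact hO p hp k Y g hB M hM hT hD hC hr hs hf hg hS hE

/-- **THE OFF-N.C. REMAINDER SPLITS EXACTLY BY KIND** (`not_sTerminates_iff`):
`WORTopSHeavyOffNC n ⟺ WORTopSFrozenOffNC n ∧ WORTopSPerpetualOffNC n`. [new] [folklore] -/
theorem worTopSHeavyOffNC_iff (n : ℕ) : WORTopSHeavyOffNC n ↔ WORTopSFrozenOffNC n ∧ WORTopSPerpetualOffNC n := by
  constructor
  · intro h
    exact ⟨fun p hp k _ _ Y g hB M hM hT hD hC hr hs hf hg hF hE =>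
        h p hp k Y g hB M hM hT hD hC hr hs hf hg ((not_sTerminates_iff n ⟨⟨Y, M.ideal⟩, none⟩).2 (Or.inl hF)) hE,
      fun p hp k _ _ Y g hB M hM hT hD hC hr hs hf hg hP hE =>
        h p hp k Y g hB M hM hT hD hC hr hs hf hg ((not_sTerminates_iff n ⟨⟨Y, M.ideal⟩, none⟩).2 (Or.inr hP)) hE⟩
  · rintro ⟨hF, hP⟩ p hp k _ _ Y g hB M hM hT hD hC hr hs hf hg hS hE
    rcases (not_sTerminates_iff n ⟨⟨Y, M.ideal⟩, none⟩).1 hS with h | h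
    · exact hF p hp k Y g hB M hM hT hD hC hr hs hf hg h hE
    · exact hP p hp k Y g hB M hM hT hD hC hr hs hf hg h hE

/-- **THE ENTRY CONJECTURE MAKES THE P‴ REMAINDER VACUOUS.** [new] [folklore] -/
theorem worTopSPerpetualOffNC_of_entry {n : ℕ} (h : NCEntryPerpetual n) : WORTopSPerpetualOffNC n :=
  fun p hp k _ _ Y g hB M hM hT hD hC hr hs hf hg hP hE => (hE (h p hp k Y g hB M hM hT hD hC hr hs hf hg hP)).elim

/-- **KIND P‴ FROM THE N.C. LAWS AND THE ENTRY CONJECTURE**: `WORNC n → WORNCHyp n → NCEntryPerpetual n → WORTopSPerpetual n`.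
[new] [folklore] -/
theorem worTopSPerpetual_of_nc {n : ℕ} (hW : WORNC n) (hH : WORNCHyp n) (hE : NCEntryPerpetual n) : WORTopSPerpetual n :=
  fun p hp k _ _ Y g hB M hM hT hD hC hr hs hf hg hP =>
    worTopSHeavyNC_of_laws hW hH p hp k Y g hB M hM hT hD hC hr hs hf hg (fun hS => hS.not_sPerpetual hP)
      (hE p hp k Y g hB M hM hT hD hC hr hs hf hg hP)

/-- **KIND F-ss² FROM THE N.C. LAWS AND ITS OFF-N.C. REMAINDER**: `WORNC n → WORNCHyp n → WORTopSFrozenOffNC n → WORTopSFrozen n`.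
[new] [folklore] -/
theorem worTopSFrozen_of_nc {n : ℕ} (hW : WORNC n) (hH : WORNCHyp n) (hO : WORTopSFrozenOffNC n) : WORTopSFrozen n := by
  intro p hp k _ _ Y g hB M hM hT hD hC hr hs hf hg hF
  by_cases hE : EverNC n ⟨⟨Y, M.ideal⟩, none⟩
  · exact worTopSHeavyNC_of_laws hW hH p hp k Y g hB M hM hT hD hC hr hs hf hg (fun hS => hS.not_sFrozen hF) hE
  · exact hO p hp k Y g hB M hM hT hD hC hr hs hf hg hF hE

/-- **THE CARVE (lens-6, g32)**: `WORNC n → WORNCHyp n → NCEntryPerpetual n → WORTopSFrozenOffNC n → WORTopSHeavy n` — the residual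
at one marking from the barrier's complement, the hypersurface-shape law, the entry conjecture and the off-n.c. frozen remainder.
[new] [folklore] -/
theorem worTopSHeavy_of_nc {n : ℕ} (hW : WORNC n) (hH : WORNCHyp n) (hE : NCEntryPerpetual n) (hO : WORTopSFrozenOffNC n) :
    WORTopSHeavy n :=
  (worTopSHeavy_iff_singSing_perpetual n).2 ⟨worTopSFrozen_of_nc hW hH hO, worTopSPerpetual_of_nc hW hH hE⟩

/-- the same with the EXACT off-n.c. remainder in place of the entry conjecture and the frozen remainder:
`WORNC n → WORNCHyp n → WORTopSHeavyOffNC n → WORTopSHeavy n`. [new] [folklore] -/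
theorem worTopSHeavy_of_nc_offNC {n : ℕ} (hW : WORNC n) (hH : WORNCHyp n) (hO : WORTopSHeavyOffNC n) : WORTopSHeavy n :=
  (worTopSHeavy_iff_nc_offNC n).2 ⟨worTopSHeavyNC_of_laws hW hH, hO⟩

/-- family of the barrier's complement (ideal shape). UNDECIDED · ATTACKABLE. -/
def E1NC : Prop := ∀ n : ℕ, 1 ≤ n → WORNC n

/-- family of the hypersurface-shape n.c. law. UNDECIDED · IDEA-NEEDED. -/
def E1NCHyp : Prop := ∀ n : ℕ, 1 ≤ n → WORNCHyp n

/-- family of the entry conjecture for kind P‴. UNDECIDED (test-bearing). -/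
def E1NCEntryPerpetual : Prop := ∀ n : ℕ, 1 ≤ n → NCEntryPerpetual n

/-- family of the off-n.c. frozen remainder. RESIDUAL. -/
def E1TopSFrozenOffNC : Prop := ∀ n : ℕ, 1 ≤ n → WORTopSFrozenOffNC n

/-- family of the exact off-n.c. remainder. RESIDUAL. -/
def E1TopSHeavyOffNC : Prop := ∀ n : ℕ, 1 ≤ n → WORTopSHeavyOffNC n

/-- **THE CARVE, families**: `E1NC → E1NCHyp → E1NCEntryPerpetual → E1TopSFrozenOffNC → E1TopSHeavy`. [new] [folklore] -/
theorem e1TopSHeavy_of_nc (hW : E1NC) (hH : E1NCHyp) (hE : E1NCEntryPerpetual) (hO : E1TopSFrozenOffNC) : E1TopSHeavy :=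
  fun n hn => worTopSHeavy_of_nc (hW n hn) (hH n hn) (hE n hn) (hO n hn)

/-- families, exact remainder: `E1NC → E1NCHyp → E1TopSHeavyOffNC → E1TopSHeavy`. [new] [folklore] -/
theorem e1TopSHeavy_of_nc_offNC (hW : E1NC) (hH : E1NCHyp) (hO : E1TopSHeavyOffNC) : E1TopSHeavy :=
  fun n hn => worTopSHeavy_of_nc_offNC (hW n hn) (hH n hn) (hO n hn)

/-- families, exact iff: `E1TopSHeavy ⟺ (∀ n ≥ 1, WORTopSHeavyNC n) ∧ E1TopSHeavyOffNC`. [new] [folklore] -/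
theorem e1TopSHeavy_iff_nc_offNC : E1TopSHeavy ↔ (∀ n : ℕ, 1 ≤ n → WORTopSHeavyNC n) ∧ E1TopSHeavyOffNC :=
  ⟨fun h => ⟨fun n hn => ((worTopSHeavy_iff_nc_offNC n).1 (h n hn)).1, fun n hn => ((worTopSHeavy_iff_nc_offNC n).1 (h n hn)).2⟩,
    fun h n hn => (worTopSHeavy_iff_nc_offNC n).2 ⟨h.1 n hn, h.2 n hn⟩⟩

/-- **EDGE TO THE LIVE ASIDE (item 27045)**: under `E 5`, `E1NC → E1NCHyp → E1NCEntryPerpetual → E1TopSFrozenOffNC → E1TopGHeavy`.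
[new] [folklore] -/
theorem e1TopGHeavy_of_nc (h5 : E 5) (hW : E1NC) (hH : E1NCHyp) (hE : E1NCEntryPerpetual) (hO : E1TopSFrozenOffNC) :
    E1TopGHeavy :=
  (e1TopGHeavy_iff_e1TopSHeavy h5).2 (e1TopSHeavy_of_nc hW hH hE hO)

/-- **EDGE TO THE COLUMN ITEM (26971)**: under `SubfieldContactAbs` and `E 5`,
`E1NC → E1NCHyp → E1NCEntryPerpetual → E1TopSFrozenOffNC → E1TopNoAbs`. [new] [folklore] -/
theorem e1TopNoAbs_of_nc (hSC : SubfieldContactAbs) (h5 : E 5) (hW : E1NC) (hH : E1NCHyp) (hE : E1NCEntryPerpetual)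
    (hO : E1TopSFrozenOffNC) : E1TopNoAbs :=
  (e1TopNoAbs_iff_e1TopSHeavy hSC h5).2 (e1TopSHeavy_of_nc hW hH hE hO)

/-- **SUMMIT EDGE of the column**: under `SubfieldContactAbs` and `E 5`,
`E1NC → E1NCHyp → E1NCEntryPerpetual → E1TopSFrozenOffNC → E 1`. [new] [folklore] -/
theorem e_one_of_nc (hSC : SubfieldContactAbs) (h5 : E 5) (hW : E1NC) (hH : E1NCHyp) (hE : E1NCEntryPerpetual)
    (hO : E1TopSFrozenOffNC) : E 1 :=
  (e_one_iff_e1TopSHeavy hSC h5).2 (e1TopSHeavy_of_nc hW hH hE hO)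

end NCCells

end Summit.ResolutionOfSingularities.ResolutionOfSingularities.Theorems.DeltaCutClasses
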